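import Summits.CriticalPhenomena.PercolationContinuityZ3.Theorems.Transplant.PlanarCellsFaces
import Literature.Probability.Percolation.GMFiniteSize
import Literature.Probability.Percolation.Towers
import HarnessLib

/-!
# Corridor chain, PLANAR GEOMETRY (Kozma–Nitzan's Lemmas 11–12 at `d = 2`, in the form the KIT framework consumes): the three kinds of
# target step of the corridor chain — ADVANCE one face along the corridor (Lemma 11's step), SHRINK the source box along the axis, SHRINK it
# across the axis (replacing Lemma 12's halving + elongated corridor step, since the product kits route through SQUARE prisms only) — each
# with its ROUTE LEMMA: from every point `v` near the core, a square `v + Λ_ℓ` inside the step's region whose quarter-face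
# `v + orthantFace a τ ℓ` lies in the next core (the deep route of p3-g2's `deep_h3`), with `ℓ ≥ ℓ₀`
# (design HOME/prim-bschramm-p2-g2/F8-DESIGN.md §7–§8; lane prim-bschramm, Corridor-over-levels)

builds on p205010 (kernel theorem, internal audit signed; external expert review pending) — nothing in this file uses p205010.
Lane `prim-bschramm`, seat `prim-bschramm-p2`; helper file (`--supports stmt-CriticalPhenomena-4575`).  Pure `Site 2` geometry over signed
boxes `sBox a σ c α β w = {α ≤ σ(x_a - c_a) ≤ β, |x_j - c_j| ≤ w}`; no probability.

* `shiftF v F = F + v`; shifted squares / quarter-faces inside signed boxes (`shift_box_subset_sBox`, `shift_orthantFace_subset_sBox`);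
* **`route_advance`** (KN p. 22: from `v` within `R'` of the face `{level = L, |trans| ≤ w}`, the quarter-face of direction `(a, σ)` at scale
  `ℓ(v) = L + s - level(v) ∈ [s - R', s + R']`, transverse sign towards the axis, lands on the face `{level = L + s, |trans| ≤ w + R'}` and its
  square lies in the region `{L - 2s ≤ level ≤ L + s, |trans| ≤ ρ}`; needs `R' + ℓ₀ ≤ s ≤ w`, `w + s + 2R' ≤ ρ`);
* **`route_shrinkLong`** (from `v` within `R'` of `{|level| ≤ u, |trans| ≤ w}` a quarter-face along the axis towards level `0` lands in
  `{|level| ≤ u', |trans| ≤ w + R'}`, `u' + Δ = u`, scale `∈ [ℓ₀, Δ + R' + ℓ₀]`, square inside `{|level|, |trans| ≤ ρ}`);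
* **`route_shrinkTrans`** (the same across the axis, landing in `{|level| ≤ u + R', |trans| ≤ w'}`, `w' + Δ = w`);
* **`route_start`** (from `v` within `R'` of the small box `{|level| ≤ q, |trans| ≤ q'}` the quarter-face along `(a, σ)` at scale
  `q + s - level(v)` lands on the first face `{level = q + s, |trans| ≤ w₁}`, `w₁ ≥ q' + 2q + s + 2R'`).
[cite: KozmaNitzan2024, §4 Lemma 11 (pp. 22–23: "choose ℓ(v) = ¾r - v₁ … F(v) = {1} × ∏ [0,1] or [-1,0]"), Lemma 12 (pp. 23–25, halving)]
[cite: GrimmettPercolation1999, §7.2 (7.6) (face orthants)]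
-/

noncomputable section

namespace Summit.CriticalPhenomena.PercolationContinuityZ3.Theorems

namespace Transplant

namespace ChainPlanar

open Literature.Probability.Percolation Literature.Probability.LatticeModels
open Literature.Probability.Percolation.KozmaNitzan
open Literature.Probability.Percolation.KozmaNitzan.Cells (oth oth_ne eq_oth_of_ne)

/-- The translate `F + v` of a planar set. [folklore] -/
def shiftF (v : Site 2) (F : Finset (Site 2)) : Finset (Site 2) := F.image fun t => t + v

/-- Membership in a translate. [folklore] -/
theorem mem_shiftF {v : Site 2} {F : Finset (Site 2)} {y : Site 2} : y ∈ shiftF v F ↔ y - v ∈ F := by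
  unfold shiftF
  rw [Finset.mem_image]
  constructor
  · rintro ⟨t, ht, rfl⟩; simpa using ht
  · intro h; exact ⟨y - v, h, by simp⟩

/-- A sign is a unit. [folklore] -/
theorem exists_unit_eq {z : ℤ} (hz : z = 1 ∨ z = -1) : ∃ u : ℤˣ, (u : ℤ) = z := by
  rcases hz with rfl | rfl
  exacts [⟨1, rfl⟩, ⟨-1, rfl⟩]

/-! ## Shifted squares and quarter-faces inside signed boxes -/

/-- **A shifted square inside a signed box**: `v + Λ_ℓ ⊆ sBox a σ c α β ρ` as soon as the level interval `[level(v) - ℓ, level(v) + ℓ]` lies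
in `[α, β]` and the transverse interval `[v_j - ℓ, v_j + ℓ]` in `[c_j - ρ, c_j + ρ]`. [folklore] -/
theorem shift_box_subset_sBox {a : Fin 2} {σ : ℤ} (hσ : σ = 1 ∨ σ = -1) {c v : Site 2} {α β ρ : ℤ} {ℓ : ℕ}
    (h1 : α ≤ σ * (v a - c a) - ℓ) (h2 : σ * (v a - c a) + ℓ ≤ β)
    (h3 : ∀ j, j ≠ a → c j - ρ ≤ v j - ℓ ∧ v j + ℓ ≤ c j + ρ) :
    shiftF v (box 2 ℓ) ⊆ sBox a σ c α β ρ := by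
  intro y hy
  rw [mem_shiftF, mem_box] at hy
  rw [mem_sBox_iff hσ]
  refine ⟨?_, fun j hj => ?_⟩
  · have hya := hy a
    simp only [Pi.sub_apply] at hya
    rcases hσ with rfl | rfl <;> constructor <;> linarith [hya.1, hya.2]
  · have hyj := hy j
    simp only [Pi.sub_apply] at hyj
    have := h3 j hj
    constructor <;> linarith [hyj.1, hyj.2, this.1, this.2]

/-- **A shifted quarter-face of direction `(a, τ_a)` at scale `ℓ`** lies in `sBox a σ c α β ρ` as soon as its level `level(v) + σ τ_a ℓ` is
in `[α, β]` and, for the transverse coordinate, both `v_j` and `v_j + τ_j ℓ` are within `ρ` of `c_j`. [folklore] -/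
theorem shift_orthantFace_subset_sBox {a : Fin 2} {σ : ℤ} (hσ : σ = 1 ∨ σ = -1) {c v : Site 2} {α β ρ : ℤ} {ℓ : ℕ}
    {τ : Fin 2 → ℤˣ}
    (h1 : α ≤ σ * (v a - c a) + σ * (τ a : ℤ) * ℓ) (h2 : σ * (v a - c a) + σ * (τ a : ℤ) * ℓ ≤ β)
    (h3 : ∀ j, j ≠ a → c j - ρ ≤ v j ∧ v j ≤ c j + ρ ∧ c j - ρ ≤ v j + (τ j : ℤ) * ℓ ∧ v j + (τ j : ℤ) * ℓ ≤ c j + ρ) :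
    shiftF v (orthantFace a τ ℓ) ⊆ sBox a σ c α β ρ := by
  intro y hy
  rw [mem_shiftF, mem_orthantFace, mem_box] at hy
  obtain ⟨hyb, hya, hyj⟩ := hy
  rw [mem_sBox_iff hσ]
  refine ⟨?_, fun j hj => ?_⟩
  · simp only [Pi.sub_apply] at hya
    have hy' : y a - v a = (τ a : ℤ) * ℓ := by
      rcases BGN.units_val_eq (τ a) with h | h <;> rw [h] at hya ⊢ <;> linarith
    have : σ * (y a - c a) = σ * (v a - c a) + σ * (τ a : ℤ) * ℓ := by linear_combination σ * hy'
    rw [this]; exact ⟨h1, h2⟩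
  · have h0 := hyj j hj
    have hb := hyb j
    simp only [Pi.sub_apply] at h0 hb
    obtain ⟨hv1, hv2, hv3, hv4⟩ := h3 j hj
    rcases BGN.units_val_eq (τ j) with h | h <;> rw [h] at h0 hv3 hv4 <;> constructor <;> linarith [hb.1, hb.2]

/-! ## The advance step (Lemma 11) -/

/-- **ROUTE FOR THE ADVANCE STEP** (KN p. 22): centre `c`, axis `a`, sign `σ`; current face level `L`, width `w`; step `s`; neighbourhood
radius `R'`; minimal scale `ℓ₀`; region half-width `ρ`; `R' + ℓ₀ ≤ s`, `2R' ≤ s ≤ w`, `w + s + 2R' ≤ ρ`.  For every `v` with `L - R' ≤ level(v) ≤ L + R'`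
and `|trans(v)| ≤ w + R'`, the scale `ℓ = L + s - level(v)` satisfies `ℓ₀ ≤ ℓ ≤ s + R'`, the square `v + Λ_ℓ` lies in the region
`sBox a σ c (L - 2s) (L + s) ρ`, and a quarter-face of direction `(a, σ)` lies in the next face `sBox a σ c (L + s) (L + s) (w + R')`.
[cite: KozmaNitzan2024, §4 Lemma 11 (pp. 22–23)] -/
theorem route_advance {a : Fin 2} {σ : ℤ} (hσ : σ = 1 ∨ σ = -1) (c : Site 2) {L s w ρ : ℤ} {R' ℓ₀ : ℕ}
    (hs : (R' : ℤ) + ℓ₀ ≤ s) (hs2 : 2 * (R' : ℤ) ≤ s) (hw : s ≤ w) (hρ : w + s + 2 * R' ≤ ρ)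
    {v : Site 2} (hv : v ∈ sBox a σ c (L - R') (L + R') (w + R')) :
    ∃ ℓ : ℕ, ℓ₀ ≤ ℓ ∧ (ℓ : ℤ) ≤ s + R' ∧ (ℓ : ℤ) = L + s - σ * (v a - c a) ∧
      shiftF v (box 2 ℓ) ⊆ sBox a σ c (L - 2 * s) (L + s) ρ ∧
      ∃ τ : Fin 2 → ℤˣ, (τ a : ℤ) = σ ∧ shiftF v (orthantFace a τ ℓ) ⊆ sBox a σ c (L + s) (L + s) (w + R') := by
  rw [mem_sBox_iff hσ] at hv
  obtain ⟨⟨hv1, hv2⟩, hvj⟩ := hv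
  have hℓ0 : 0 ≤ L + s - σ * (v a - c a) := by omega
  obtain ⟨ℓ, hℓ⟩ : ∃ ℓ : ℕ, (ℓ : ℤ) = L + s - σ * (v a - c a) := ⟨_, Int.toNat_of_nonneg hℓ0⟩
  have hℓlo : (ℓ₀ : ℤ) ≤ ℓ := by omega
  have hℓhi : (ℓ : ℤ) ≤ s + R' := by omega
  -- the signs: along the axis `σ`, across it towards the centre line
  obtain ⟨σu, hσu⟩ := exists_unit_eq hσ
  let τ : Fin 2 → ℤˣ := fun j => if j = a then σu else if c j < v j then -1 else 1
  have hτa : (τ a : ℤ) = σ := by simp only [τ, if_true]; exact hσu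
  refine ⟨ℓ, by exact_mod_cast hℓlo, hℓhi, hℓ, ?_, τ, hτa, ?_⟩
  · refine shift_box_subset_sBox hσ (by omega) (by omega) fun j hj => ?_
    have := hvj j hj
    constructor <;> omega
  · have hσσ : σ * σ = 1 := by rcases hσ with h | h <;> simp [h]
    have hlev : σ * (v a - c a) + σ * (τ a : ℤ) * ℓ = L + s := by
      rw [hτa]
      calc σ * (v a - c a) + σ * σ * ℓ = σ * (v a - c a) + ℓ := by rw [hσσ, one_mul]
        _ = L + s := by omega
    refine shift_orthantFace_subset_sBox hσ (by rw [hlev]) (by rw [hlev]) fun j hj => ?_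
    have hvj' := hvj j hj
    by_cases hlt : c j < v j
    · have hτj : (τ j : ℤ) = -1 := by simp only [τ, if_neg hj, hlt, if_true, Units.val_neg, Units.val_one]
      rw [hτj]
      refine ⟨by omega, by omega, by omega, by omega⟩
    · have hτj : (τ j : ℤ) = 1 := by simp only [τ, if_neg hj, hlt, if_false, Units.val_one]
      rw [hτj]
      refine ⟨by omega, by omega, by omega, by omega⟩

/-! ## The shrinking steps (Lemma 12's halving, iterated) -/

/-- The scale of a shrinking route: at least `ℓ₀`, and enough to bring `|z|` down to `t` (moving towards `0`). [folklore] -/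
theorem exists_shrink_scale (z t : ℤ) (ℓ₀ : ℕ) (ht : (ℓ₀ : ℤ) ≤ t) {B : ℤ} (hz : |z| ≤ B) (htB : t ≤ B) :
    ∃ (ℓ : ℕ) (dir : ℤ), (dir = 1 ∨ dir = -1) ∧ (ℓ₀ : ℤ) ≤ ℓ ∧ (ℓ : ℤ) ≤ B - t + ℓ₀ ∧
      -t ≤ z + dir * ℓ ∧ z + dir * ℓ ≤ t := by
  by_cases h0 : 0 ≤ z
  · rw [abs_of_nonneg h0] at hz
    have hℓ0' : 0 ≤ max (ℓ₀ : ℤ) (z - t) := le_max_of_le_left (by positivity)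
    obtain ⟨ℓ, hℓ⟩ : ∃ ℓ : ℕ, (ℓ : ℤ) = max (ℓ₀ : ℤ) (z - t) := ⟨_, Int.toNat_of_nonneg hℓ0'⟩
    refine ⟨ℓ, -1, Or.inr rfl, ?_⟩
    rcases le_total (ℓ₀ : ℤ) (z - t) with h | h
    · rw [max_eq_right h] at hℓ; refine ⟨?_, ?_, ?_, ?_⟩ <;> omega
    · rw [max_eq_left h] at hℓ; refine ⟨?_, ?_, ?_, ?_⟩ <;> omega
  · push Not at h0
    rw [abs_of_neg h0] at hz
    have hℓ0' : 0 ≤ max (ℓ₀ : ℤ) (-z - t) := le_max_of_le_left (by positivity)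
    obtain ⟨ℓ, hℓ⟩ : ∃ ℓ : ℕ, (ℓ : ℤ) = max (ℓ₀ : ℤ) (-z - t) := ⟨_, Int.toNat_of_nonneg hℓ0'⟩
    refine ⟨ℓ, 1, Or.inl rfl, ?_⟩
    rcases le_total (ℓ₀ : ℤ) (-z - t) with h | h
    · rw [max_eq_right h] at hℓ; refine ⟨?_, ?_, ?_, ?_⟩ <;> omega
    · rw [max_eq_left h] at hℓ; refine ⟨?_, ?_, ?_, ?_⟩ <;> omega

/-- **ROUTE FOR THE SHRINK-ALONG STEP**: from `v` within `R'` of the box `{|level| ≤ u, |trans| ≤ w}`, a quarter-face along the axis towards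
level `0` at a scale `ℓ ∈ [ℓ₀, Δ + R' + ℓ₀]` lands in `{|level| ≤ u', |trans| ≤ w + R'}`, where `u' + Δ = u`, `ℓ₀ ≤ u'`, `Δ + ℓ₀ ≤ w`; its
square lies in the box `{|level| ≤ ρ, |trans| ≤ ρ}` once `u + Δ + 2R' + ℓ₀ ≤ ρ` and `w + Δ + 2R' + ℓ₀ ≤ ρ`.
[cite: KozmaNitzan2024, §4 Lemma 12 (pp. 23–25, the halving steps)] -/
theorem route_shrinkLong {a : Fin 2} {σ : ℤ} (hσ : σ = 1 ∨ σ = -1) (c : Site 2) {u u' w Δ ρ : ℤ} {R' ℓ₀ : ℕ}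
    (hu : u' + Δ = u) (hu' : (ℓ₀ : ℤ) ≤ u') (hΔ : 0 ≤ Δ) (hΔw : Δ + ℓ₀ ≤ w) (hρu : u + Δ + 2 * R' + ℓ₀ ≤ ρ)
    (hρw : w + Δ + 2 * R' + ℓ₀ ≤ ρ)
    {v : Site 2} (hv : v ∈ sBox a σ c (-u - R') (u + R') (w + R')) :
    ∃ ℓ : ℕ, ℓ₀ ≤ ℓ ∧ (ℓ : ℤ) ≤ Δ + R' + ℓ₀ ∧
      shiftF v (box 2 ℓ) ⊆ sBox a σ c (-ρ) ρ ρ ∧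
      ∃ τ : Fin 2 → ℤˣ, shiftF v (orthantFace a τ ℓ) ⊆ sBox a σ c (-u') u' (w + R') := by
  rw [mem_sBox_iff hσ] at hv
  obtain ⟨⟨hv1, hv2⟩, hvj⟩ := hv
  have hB : |σ * (v a - c a)| ≤ u + R' := abs_le.2 ⟨by omega, by omega⟩
  obtain ⟨ℓ, dir, hdir, hℓlo, hℓhi, hnew1, hnew2⟩ := exists_shrink_scale (σ * (v a - c a)) u' ℓ₀ hu' hB (by omega)
  have hσdir : σ * dir = 1 ∨ σ * dir = -1 := by
    rcases hσ with h | h <;> rcases hdir with h' | h' <;> simp [h, h']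
  obtain ⟨τa, hτa⟩ := exists_unit_eq hσdir
  let τ : Fin 2 → ℤˣ := fun j => if j = a then τa else if c j < v j then -1 else 1
  have hτa' : (τ a : ℤ) = σ * dir := by simp only [τ, if_true]; exact hτa
  refine ⟨ℓ, by exact_mod_cast hℓlo, by omega, ?_, τ, ?_⟩
  · refine shift_box_subset_sBox hσ (by omega) (by omega) fun j hj => ?_
    have := hvj j hj
    constructor <;> omega
  · have hσσ : σ * σ = 1 := by rcases hσ with h | h <;> simp [h]
    have hkey : σ * (v a - c a) + σ * (τ a : ℤ) * ℓ = σ * (v a - c a) + dir * ℓ := by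
      rw [hτa']
      calc σ * (v a - c a) + σ * (σ * dir) * ℓ = σ * (v a - c a) + σ * σ * dir * ℓ := by ring
        _ = _ := by rw [hσσ, one_mul]
    refine shift_orthantFace_subset_sBox hσ (by rw [hkey]; exact hnew1) (by rw [hkey]; exact hnew2) fun j hj => ?_
    have hvj' := hvj j hj
    by_cases hlt : c j < v j
    · have hτj : (τ j : ℤ) = -1 := by simp only [τ, if_neg hj, hlt, if_true, Units.val_neg, Units.val_one]
      rw [hτj]
      refine ⟨by omega, by omega, by omega, by omega⟩
    · have hτj : (τ j : ℤ) = 1 := by simp only [τ, if_neg hj, hlt, if_false, Units.val_one]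
      rw [hτj]
      refine ⟨by omega, by omega, by omega, by omega⟩

/-- **ROUTE FOR THE SHRINK-ACROSS STEP**: from `v` within `R'` of `{|level| ≤ u, |trans| ≤ w}`, a quarter-face ACROSS the axis towards the
centre line at a scale `ℓ ∈ [ℓ₀, Δ + R' + ℓ₀]` lands in `{|level| ≤ u + R', |trans| ≤ w'}`, where `w' + Δ = w`, `ℓ₀ ≤ w'`, `Δ + ℓ₀ ≤ u`;
its square lies in `{|level| ≤ ρ, |trans| ≤ ρ}` once `u + Δ + 2R' + ℓ₀ ≤ ρ` and `w + Δ + 2R' + ℓ₀ ≤ ρ`.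
[cite: KozmaNitzan2024, §4 Lemma 12 (pp. 23–25, halving)] -/
theorem route_shrinkTrans {a : Fin 2} {σ : ℤ} (hσ : σ = 1 ∨ σ = -1) (c : Site 2) {u w w' Δ ρ : ℤ} {R' ℓ₀ : ℕ}
    (hw : w' + Δ = w) (hw' : (ℓ₀ : ℤ) ≤ w') (hΔ : 0 ≤ Δ) (hΔu : Δ + ℓ₀ ≤ u) (hρu : u + Δ + 2 * R' + ℓ₀ ≤ ρ)
    (hρw : w + Δ + 2 * R' + ℓ₀ ≤ ρ)
    {v : Site 2} (hv : v ∈ sBox a σ c (-u - R') (u + R') (w + R')) :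
    ∃ ℓ : ℕ, ℓ₀ ≤ ℓ ∧ (ℓ : ℤ) ≤ Δ + R' + ℓ₀ ∧
      shiftF v (box 2 ℓ) ⊆ sBox a σ c (-ρ) ρ ρ ∧
      ∃ τ : Fin 2 → ℤˣ, shiftF v (orthantFace (oth a) τ ℓ) ⊆ sBox a σ c (-u - R') (u + R') w' := by
  rw [mem_sBox_iff hσ] at hv
  obtain ⟨⟨hv1, hv2⟩, hvj⟩ := hv
  have hb : oth a ≠ a := oth_ne a
  have hvb := hvj (oth a) hb
  have hB : |v (oth a) - c (oth a)| ≤ w + R' := abs_le.2 ⟨by omega, by omega⟩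
  obtain ⟨ℓ, dir, hdir, hℓlo, hℓhi, hnew1, hnew2⟩ := exists_shrink_scale (v (oth a) - c (oth a)) w' ℓ₀ hw' hB (by omega)
  obtain ⟨τb, hτb⟩ := exists_unit_eq hdir
  -- along the axis: towards level `0`
  have hdira : (if 0 ≤ σ * (v a - c a) then -σ else σ) = 1 ∨ (if 0 ≤ σ * (v a - c a) then -σ else σ) = -1 := by
    by_cases h0 : 0 ≤ σ * (v a - c a) <;> simp only [h0, if_true, if_false] <;> omega
  obtain ⟨τa, hτa⟩ := exists_unit_eq hdira
  let τ : Fin 2 → ℤˣ := fun j => if j = a then τa else τb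
  have hτA : τ a = τa := by simp only [τ, if_true]
  have hτB : τ (oth a) = τb := by simp only [τ, if_neg hb]
  refine ⟨ℓ, by exact_mod_cast hℓlo, by omega, ?_, τ, ?_⟩
  · refine shift_box_subset_sBox hσ (by omega) (by omega) fun j hj => ?_
    have := hvj j hj
    constructor <;> omega
  · intro y hy
    rw [mem_shiftF, mem_orthantFace, mem_box] at hy
    obtain ⟨hyb, hyB, hyj⟩ := hy
    rw [mem_sBox_iff hσ]
    have hσσ : σ * σ = 1 := by rcases hσ with h | h <;> simp [h]
    refine ⟨?_, fun j hj => ?_⟩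
    · -- the level moves towards `0` by at most `ℓ ≤ Δ + R' + ℓ₀ ≤ u + R'`… and stays within `u + R'`
      have h0 := hyj a hb.symm
      have hba := hyb a
      simp only [Pi.sub_apply, hτA, hτa] at h0 hba
      have : σ * (y a - c a) = σ * (v a - c a) + σ * (y a - v a) := by ring
      rw [this]
      by_cases hl : 0 ≤ σ * (v a - c a)
      · rw [if_pos hl] at h0
        rcases hσ with h | h <;> subst h <;> constructor <;> nlinarith
      · rw [if_neg hl] at h0
        push Not at hl
        rcases hσ with h | h <;> subst h <;> constructor <;> nlinarith
    · -- the transverse coordinate lands at `v_b + dir ℓ`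
      have hjb : j = oth a := eq_oth_of_ne hj
      subst hjb
      simp only [Pi.sub_apply, hτB, hτb] at hyB
      have hyval : y (oth a) = v (oth a) + dir * ℓ := by
        rcases hdir with h | h <;> rw [h] at hyB ⊢ <;> linarith
      rw [hyval]
      constructor <;> linarith

/-! ## The start of the advance (from a small box to the first face) -/

/-- **ROUTE FOR THE START STEP**: from `v` within `R'` of the small box `{|level| ≤ q, |trans| ≤ q'}`, the quarter-face of direction `(a, σ)`
at scale `ℓ = q + s - level(v) ∈ [s - R', 2q + s + R']` lands on the first face `{level = q + s, |trans| ≤ w₁}` for any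
`w₁ ≥ q' + 2q + s + 2R'`, and its square lies in `{-ρ ≤ level ≤ q + s, |trans| ≤ ρ}` once `q' + 2q + s + 2R' ≤ ρ` and `3q + s + 2R' ≤ ρ`.
[cite: KozmaNitzan2024, §4 Lemma 11 (pp. 22–23), Lemma 12 (pp. 23–25)] -/
theorem route_start {a : Fin 2} {σ : ℤ} (hσ : σ = 1 ∨ σ = -1) (c : Site 2) {q q' s w₁ ρ : ℤ} {R' ℓ₀ : ℕ}
    (hs : (R' : ℤ) + ℓ₀ ≤ s) (hw₁ : q' + 2 * q + s + 2 * R' ≤ w₁) (hρ : q' + 2 * q + s + 2 * R' ≤ ρ)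
    (hρ' : 3 * q + s + 2 * R' ≤ ρ)
    {v : Site 2} (hv : v ∈ sBox a σ c (-q - R') (q + R') (q' + R')) :
    ∃ ℓ : ℕ, ℓ₀ ≤ ℓ ∧ (ℓ : ℤ) ≤ 2 * q + s + R' ∧ (ℓ : ℤ) = q + s - σ * (v a - c a) ∧
      shiftF v (box 2 ℓ) ⊆ sBox a σ c (-ρ) (q + s) ρ ∧
      ∃ τ : Fin 2 → ℤˣ, (τ a : ℤ) = σ ∧ shiftF v (orthantFace a τ ℓ) ⊆ sBox a σ c (q + s) (q + s) w₁ := by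
  rw [mem_sBox_iff hσ] at hv
  obtain ⟨⟨hv1, hv2⟩, hvj⟩ := hv
  have hℓ0 : 0 ≤ q + s - σ * (v a - c a) := by omega
  obtain ⟨ℓ, hℓ⟩ : ∃ ℓ : ℕ, (ℓ : ℤ) = q + s - σ * (v a - c a) := ⟨_, Int.toNat_of_nonneg hℓ0⟩
  have hℓlo : (ℓ₀ : ℤ) ≤ ℓ := by omega
  have hℓhi : (ℓ : ℤ) ≤ 2 * q + s + R' := by omega
  obtain ⟨σu, hσu⟩ := exists_unit_eq hσ
  let τ : Fin 2 → ℤˣ := fun j => if j = a then σu else if c j < v j then -1 else 1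
  have hτa : (τ a : ℤ) = σ := by simp only [τ, if_true]; exact hσu
  refine ⟨ℓ, by exact_mod_cast hℓlo, hℓhi, hℓ, ?_, τ, hτa, ?_⟩
  · refine shift_box_subset_sBox hσ (by omega) (by omega) fun j hj => ?_
    have := hvj j hj
    constructor <;> omega
  · have hσσ : σ * σ = 1 := by rcases hσ with h | h <;> simp [h]
    have hlev : σ * (v a - c a) + σ * (τ a : ℤ) * ℓ = q + s := by
      rw [hτa]
      calc σ * (v a - c a) + σ * σ * ℓ = σ * (v a - c a) + ℓ := by rw [hσσ, one_mul]
        _ = q + s := by omega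
    refine shift_orthantFace_subset_sBox hσ (by rw [hlev]) (by rw [hlev]) fun j hj => ?_
    have hvj' := hvj j hj
    by_cases hlt : c j < v j
    · have hτj : (τ j : ℤ) = -1 := by simp only [τ, if_neg hj, hlt, if_true, Units.val_neg, Units.val_one]
      rw [hτj]
      refine ⟨by omega, by omega, by omega, by omega⟩
    · have hτj : (τ j : ℤ) = 1 := by simp only [τ, if_neg hj, hlt, if_false, Units.val_one]
      rw [hτj]
      refine ⟨by omega, by omega, by omega, by omega⟩

end ChainPlanar

end Transplant

end Summit.CriticalPhenomena.PercolationContinuityZ3.Theorems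

end
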